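/-
Origin: written from primary sources — S. Kudla, *Seesaw dual reductive pairs* (1984) §1 (see-saw identity of theta integrals);
A. Borel, N. Wallach, *Continuous cohomology, discrete subgroups, and representations of reductive groups* (2000) VII §3
(vector-valued automorphic forms of a given `K`-type; the wedge of two one-forms as a scalar function of weight `∧²τ`).
Adapted: no. Abstract over the tree's `ThetaKernelDatum` / `ThetaWeightForms.thetaForm` / `ThetaLiftSeesawProduct`; kernel only,
no records.
-/
import Literature.NumberTheory.Weil1964.ThetaLiftSeesawProduct
import HarnessLib

/-!
# The wedge of two vector-valued theta forms is ONE torus period of the big theta kernel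

For two `W`-valued theta forms of weight `τ` (tree `ThetaKernelDatum.thetaForm`, `Weil1964/ThetaWeightForms`) attached to the
small pairs `(GU, U₁)`, `(GU, U₂)` of a see-saw — `F₁ = thetaForm M₁ μ₁ … j₁ … ι₁ … f₁`, `F₂ = thetaForm M₂ μ₂ … j₂ … ι₂ … f₂` —
and a pair of linear forms `ℓ₁, ℓ₂ ∈ W^∨` (a basis of `W^∨` when `dim W = 2`: the two components of a one-form), the WEDGE
FUNCTION

  `(F₁ ∧ F₂)(g) := ℓ₁(F₁ g) ℓ₂(F₂ g) − ℓ₂(F₁ g) ℓ₁(F₂ g)`   (`wedgeFun ℓ₁ ℓ₂ F₁ F₂`)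

is, value by value, the `2 × 2` determinant of the scalar theta lifts `Θ̃_{j_a(ι_a ℓ_b)}(f_a)(g)` (`apply_thetaForm`), hence —
by the see-saw identity for lifts (`ThetaLiftSeesawProduct.seesaw_period_wedge_eq_det`) — the period over the see-saw torus
`[U₁] × [U₂]` of the big pair's theta kernel of ONE test function `Ψ′` (any `Ψ′` whose kernel is
`θ_{φ₁₁ ⊗ φ₂₂} − θ_{φ₁₂ ⊗ φ₂₁}`, `φ_{ab} = j_a(ι_a ℓ_b)`) against `f₁ ⊠ f₂`:

  **`wedgeFun_thetaForm_eq_seesaw_period`**: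
  `(F₁ ∧ F₂)(g) = ∫_{[U₁]×[U₂]} θ_{Ψ′}(g⁻¹ ΓU, bd(q₁,q₂)) f₁(q₁) f₂(q₂) d(μ₁ ⊗ μ₂)`.

This is the shape of PerL v5 (eq:Qaut)/(eq:seesaw) (tex l. 249, ll. 323–325): «`u₁ ∧ u₂` is the scalar function
`u₁¹u₂² − u₁²u₂¹`» and it is a `(12)`-theta lift of the big pair.  At the splitting data of record the hypotheses
`IsSeesawProduct` are discharged by `GelbartRogawski1991/UnitaryDualPairSeesawThetaPeriod` (`isSeesawProduct_seesawTensor`,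
`thetaKernelDatum_thetaFun_seesawWedge`).

Provenance / use (Hodge-CM model-construction cell, rows `gen12`/`real34`): PKG consumer `Gen12FunBridge.wf_gen` of
`HodgeCM/Model/Binders/MeetBridges.lean` with `wf Γ ω₁ ω₂ :=` the wedge function of weight forms representing the classes
`ω₁, ω₂`.  Nothing here is a claim of the manuscripts under adjudication.
-/

set_option autoImplicit false

noncomputable section

open _root_.MeasureTheory Function Module
open Literature.MeasureTheory.Integral Literature.NumberTheory.Automorphic
open Literature.NumberTheory.Automorphic.WeightForms

namespace Literature.NumberTheory.Weil1964

/-! ## §1 The wedge function of two `W`-valued functions against a pair of linear forms -/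

section WedgeFun

variable {X : Type*} {W : Type*} [AddCommGroup W] [Module ℂ W]

/-- **`(F₁ ∧ F₂)(x) = ℓ₁(F₁ x) ℓ₂(F₂ x) − ℓ₂(F₁ x) ℓ₁(F₂ x)`** — the wedge of two `W`-valued functions read against the pair
of linear forms `(ℓ₁, ℓ₂)` (for `dim W = 2` and `(ℓ₁, ℓ₂)` the dual basis: the coefficient of `e¹ ∧ e²`).
[cite: BorelWallach2000, VII §3] -/
def wedgeFun (ℓ₁ ℓ₂ : Dual ℂ W) (F₁ F₂ : X → W) : X → ℂ :=
  fun x => ℓ₁ (F₁ x) * ℓ₂ (F₂ x) - ℓ₂ (F₁ x) * ℓ₁ (F₂ x)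

/-- Unfolding. [folklore] -/
@[simp] theorem wedgeFun_apply (ℓ₁ ℓ₂ : Dual ℂ W) (F₁ F₂ : X → W) (x : X) :
    wedgeFun ℓ₁ ℓ₂ F₁ F₂ x = ℓ₁ (F₁ x) * ℓ₂ (F₂ x) - ℓ₂ (F₁ x) * ℓ₁ (F₂ x) := rfl

/-- antisymmetry in the functions: `F₂ ∧ F₁ = −(F₁ ∧ F₂)`. [folklore] -/
theorem wedgeFun_swap (ℓ₁ ℓ₂ : Dual ℂ W) (F₁ F₂ : X → W) : wedgeFun ℓ₁ ℓ₂ F₂ F₁ = -wedgeFun ℓ₁ ℓ₂ F₁ F₂ := by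
  funext x; simp only [wedgeFun_apply, Pi.neg_apply]; ring

/-- antisymmetry in the forms: reading against `(ℓ₂, ℓ₁)` changes the sign. [folklore] -/
theorem wedgeFun_swap_forms (ℓ₁ ℓ₂ : Dual ℂ W) (F₁ F₂ : X → W) : wedgeFun ℓ₂ ℓ₁ F₁ F₂ = -wedgeFun ℓ₁ ℓ₂ F₁ F₂ := by
  funext x; simp only [wedgeFun_apply, Pi.neg_apply]; ring

/-- `F ∧ F = 0`. [folklore] -/
@[simp] theorem wedgeFun_self (ℓ₁ ℓ₂ : Dual ℂ W) (F : X → W) : wedgeFun ℓ₁ ℓ₂ F F = 0 := by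
  funext x; simp only [wedgeFun_apply, Pi.zero_apply]; ring

/-- left invariance is inherited: if `F₁, F₂` are left-`Γ`-invariant so is `F₁ ∧ F₂`. [folklore] -/
theorem wedgeFun_mul_left {G : Type*} [Mul G] {γ : G} (ℓ₁ ℓ₂ : Dual ℂ W) {F₁ F₂ : G → W}
    (h₁ : ∀ g, F₁ (γ * g) = F₁ g) (h₂ : ∀ g, F₂ (γ * g) = F₂ g) (g : G) :
    wedgeFun ℓ₁ ℓ₂ F₁ F₂ (γ * g) = wedgeFun ℓ₁ ℓ₂ F₁ F₂ g := by
  simp only [wedgeFun_apply, h₁, h₂]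

end WedgeFun

/-! ## §2 The wedge of two theta forms is a see-saw torus period -/

namespace ThetaKernelDatum

universe u v

section Wedge

variable {Mp : Type u} {SX : Type v} [TopologicalSpace Mp] [Group Mp] [TopologicalSpace SX]
variable {Mp₁ : Type*} {SX₁ : Type*} [TopologicalSpace Mp₁] [Group Mp₁] [TopologicalSpace SX₁]
  [AddCommGroup SX₁] [Module ℂ SX₁]
variable {Mp₂ : Type*} {SX₂ : Type*} [TopologicalSpace Mp₂] [Group Mp₂] [TopologicalSpace SX₂]
  [AddCommGroup SX₂] [Module ℂ SX₂]
variable {GU : Type*} [Group GU] [TopologicalSpace GU] [IsTopologicalGroup GU] {ΓU : Subgroup GU}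
variable {G : Type*} [Group G] [TopologicalSpace G] [IsTopologicalGroup G] {Γ : Subgroup G}
variable {U₁ : Type*} [Group U₁] [TopologicalSpace U₁] [IsTopologicalGroup U₁] {Γ₁ : Subgroup U₁}
variable {U₂ : Type*} [Group U₂] [TopologicalSpace U₂] [IsTopologicalGroup U₂] {Γ₂ : Subgroup U₂}
variable (M : ThetaKernelDatum Mp SX GU ΓU G Γ) (M₁ : ThetaKernelDatum Mp₁ SX₁ GU ΓU U₁ Γ₁)
  (M₂ : ThetaKernelDatum Mp₂ SX₂ GU ΓU U₂ Γ₂)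
variable {bd : U₁ × U₂ →* G} (hbd : ∀ γ₁ ∈ Γ₁, ∀ γ₂ ∈ Γ₂, bd (γ₁, γ₂) ∈ Γ)
variable [CompactSpace (GU ⧸ ΓU)]
  [CompactSpace (U₁ ⧸ Γ₁)] [MeasurableSpace (U₁ ⧸ Γ₁)] [BorelSpace (U₁ ⧸ Γ₁)]
  (μ₁ : Measure (U₁ ⧸ Γ₁)) [IsFiniteMeasure μ₁]
  [CompactSpace (U₂ ⧸ Γ₂)] [MeasurableSpace (U₂ ⧸ Γ₂)] [BorelSpace (U₂ ⧸ Γ₂)]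
  (μ₂ : Measure (U₂ ⧸ Γ₂)) [IsFiniteMeasure μ₂]
  (hlin₁ : M₁.W.ThetaLinear) (hlin₂ : M₂.W.ThetaLinear)
variable {Kc : Type*} [Group Kc] (κ : Kc →* GU)
variable {E₁ : Type*} [AddCommGroup E₁] [Module ℂ E₁] {σ₁ : Representation ℂ Kc E₁} (j₁ : E₁ →ₗ[ℂ] SX₁)
  (hj₁ : M₁.IsThetaEquivariant κ σ₁ j₁)
variable {E₂ : Type*} [AddCommGroup E₂] [Module ℂ E₂] {σ₂ : Representation ℂ Kc E₂} (j₂ : E₂ →ₗ[ℂ] SX₂)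
  (hj₂ : M₂.IsThetaEquivariant κ σ₂ j₂)
variable {W : Type*} [AddCommGroup W] [Module ℂ W] {τ : Representation ℂ Kc W} [IsReflexive ℂ W]
variable (ι₁ : Dual ℂ W →ₗ[ℂ] E₁) (hι₁ : ∀ (k : Kc) (ℓ : Dual ℂ W), ι₁ (τ.dual k ℓ) = σ₁ k (ι₁ ℓ))
  (ι₂ : Dual ℂ W →ₗ[ℂ] E₂) (hι₂ : ∀ (k : Kc) (ℓ : Dual ℂ W), ι₂ (τ.dual k ℓ) = σ₂ k (ι₂ ℓ))

/-- **The wedge of two theta forms, value by value, is the `2 × 2` determinant of scalar lifts**: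
`(F₁ ∧ F₂)(g) = Θ̃¹_{j₁(ι₁ ℓ₁)}(f₁)(g) Θ̃²_{j₂(ι₂ ℓ₂)}(f₂)(g) − Θ̃¹_{j₁(ι₁ ℓ₂)}(f₁)(g) Θ̃²_{j₂(ι₂ ℓ₁)}(f₂)(g)`. [folklore] -/
theorem wedgeFun_thetaForm_apply (ℓ₁ ℓ₂ : Dual ℂ W) (f₁ : C(U₁ ⧸ Γ₁, ℂ)) (f₂ : C(U₂ ⧸ Γ₂, ℂ)) (g : GU) :
    wedgeFun ℓ₁ ℓ₂ (M₁.thetaForm μ₁ hlin₁ κ j₁ hj₁ ι₁ hι₁ f₁ : GU → W) (M₂.thetaForm μ₂ hlin₂ κ j₂ hj₂ ι₂ hι₂ f₂ : GU → W) g =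
      M₁.thetaLiftFun μ₁ (j₁ (ι₁ ℓ₁)) f₁ g * M₂.thetaLiftFun μ₂ (j₂ (ι₂ ℓ₂)) f₂ g -
        M₁.thetaLiftFun μ₁ (j₁ (ι₁ ℓ₂)) f₁ g * M₂.thetaLiftFun μ₂ (j₂ (ι₂ ℓ₁)) f₂ g := by
  rw [wedgeFun_apply, M₁.apply_thetaForm, M₂.apply_thetaForm, M₁.apply_thetaForm, M₂.apply_thetaForm]

/-- **THE WEDGE OF TWO THETA FORMS IS ONE SEE-SAW TORUS PERIOD**: for any big test function `Ψ′` whose kernel is the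
difference of the two product kernels `θ_{Ψ₁} − θ_{Ψ₂}`, `Ψ₁ ↔ (j₁(ι₁ ℓ₁), j₂(ι₂ ℓ₂))`, `Ψ₂ ↔ (j₁(ι₁ ℓ₂), j₂(ι₂ ℓ₁))`
(`IsSeesawProduct`), and every `g ∈ GU`:
`(F₁ ∧ F₂)(g) = ∫_{[U₁]×[U₂]} θ_{Ψ′}(g⁻¹ ΓU, bd(q₁,q₂)) f₁(q₁) f₂(q₂) d(μ₁ ⊗ μ₂)`. [cite: Kudla1984, §1] -/
theorem wedgeFun_thetaForm_eq_seesaw_period (ℓ₁ ℓ₂ : Dual ℂ W) (f₁ : C(U₁ ⧸ Γ₁, ℂ)) (f₂ : C(U₂ ⧸ Γ₂, ℂ))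
    {Ψ' Ψ₁ Ψ₂ : SX}
    (hΨ' : ∀ (x : GU) (y : G), M.thetaFun Ψ' (x, y) = M.thetaFun Ψ₁ (x, y) - M.thetaFun Ψ₂ (x, y))
    (h₁ : IsSeesawProduct M M₁ M₂ bd Ψ₁ (j₁ (ι₁ ℓ₁)) (j₂ (ι₂ ℓ₂)))
    (h₂ : IsSeesawProduct M M₁ M₂ bd Ψ₂ (j₁ (ι₁ ℓ₂)) (j₂ (ι₂ ℓ₁))) (g : GU) :
    wedgeFun ℓ₁ ℓ₂ (M₁.thetaForm μ₁ hlin₁ κ j₁ hj₁ ι₁ hι₁ f₁ : GU → W) (M₂.thetaForm μ₂ hlin₂ κ j₂ hj₂ ι₂ hι₂ f₂ : GU → W) g =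
      ∫ q : (U₁ ⧸ Γ₁) × (U₂ ⧸ Γ₂), M.thetaKer Ψ' (QuotientGroup.mk g⁻¹, seesawQuot bd hbd q) * (f₁ q.1 * f₂ q.2)
        ∂(μ₁.prod μ₂) := by
  rw [M₁.wedgeFun_thetaForm_apply M₂ μ₁ μ₂ hlin₁ hlin₂ κ j₁ hj₁ j₂ hj₂ ι₁ hι₁ ι₂ hι₂, thetaLiftFun_apply, thetaLiftFun_apply,
    thetaLiftFun_apply, thetaLiftFun_apply]
  exact (seesaw_period_wedge_eq_det hbd μ₁ μ₂ hΨ' h₁ h₂ f₁ f₂ (QuotientGroup.mk g⁻¹)).symm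

/-- **… and with a product kernel** (no antisymmetrisation): each PRODUCT of components
`ℓ₁(F₁ g) · ℓ₂(F₂ g)` is the period of `θ_Ψ`, `Ψ ↔ (j₁(ι₁ ℓ₁), j₂(ι₂ ℓ₂))`. [cite: Kudla1984, §1] -/
theorem apply_thetaForm_mul_eq_seesaw_period (ℓ₁ ℓ₂ : Dual ℂ W) (f₁ : C(U₁ ⧸ Γ₁, ℂ)) (f₂ : C(U₂ ⧸ Γ₂, ℂ)) {Ψ : SX}
    (h : IsSeesawProduct M M₁ M₂ bd Ψ (j₁ (ι₁ ℓ₁)) (j₂ (ι₂ ℓ₂))) (g : GU) :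
    ℓ₁ ((M₁.thetaForm μ₁ hlin₁ κ j₁ hj₁ ι₁ hι₁ f₁ : GU → W) g) * ℓ₂ ((M₂.thetaForm μ₂ hlin₂ κ j₂ hj₂ ι₂ hι₂ f₂ : GU → W) g) =
      ∫ q : (U₁ ⧸ Γ₁) × (U₂ ⧸ Γ₂), M.thetaKer Ψ (QuotientGroup.mk g⁻¹, seesawQuot bd hbd q) * (f₁ q.1 * f₂ q.2)
        ∂(μ₁.prod μ₂) := by
  rw [M₁.apply_thetaForm, M₂.apply_thetaForm]
  exact (seesaw_period_eq_thetaLiftFun_mul hbd μ₁ μ₂ h f₁ f₂ g).symm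

end Wedge

end ThetaKernelDatum

end Literature.NumberTheory.Weil1964

end
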